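import Literature.Geometry.Lorentzian.CoordTensorStarBounds
import Literature.Geometry.Lorentzian.CoordBochner
import HarnessLib

/-!
# The `Rm ∗ ∇Rm` terms of `Δ∇Rm`: commutator, `∇(Rm ∗ Rm)`, `d^∇Ric ∗ Rm`, and Kato's inequality

Continuation of `CoordTensorStarBounds.lean`, towards the second half of Munteanu–Wang 2015,
Thm. 1.4 (`|∇Rm|` bounded on a complete 4-d gradient shrinker with bounded scalar curvature) via
their formula (u1), `Δ_f ∇Rm = ∇Rm + Rm ∗ ∇Rm`. For a single metric `G` (`IsMetricOn G V`) and a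
basis `b`, at a positive definite point `x ∈ V`, every `∗`-term of `Δ∇Rm − ∇ΔRm` and of
`∇(Rm ∗ Rm)` is written as a trace of a relabelled tensor product of `rm4` with `∇ rm4`
(Topping 2006, (2.1.6) and §2.2) and bounded by a dimensional multiple of `|Rm| |∇Rm|`:

* `IsMetricOn.tcov_ricTerm_rm4_apply`, `IsMetricOn.tcov_tcov2Alt_rm4_apply` — `∇(W Rm)` with
  `W = tcov2Alt` the antisymmetrised second derivative (Ricci identity `W Rm = −Σ_a Rm ⋆_a Rm`);
  **`IsMetricOn.sqrt_tnormSq_commutator_le` — `|[Δ,∇]Rm| ≤ 13 n |Rm| |∇Rm|`** for the trace field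
  of `tlap_tcov_sub_tcov_tlap`;
* `IsMetricOn.tcov_rrField_apply`, **`IsMetricOn.sqrt_tnormSq_tcov_rrField_le` —
  `|∇ tr tr((Rm ⊗ Rm) ∘ e)| ≤ 2n |Rm| |∇Rm|`** for the six `Rm ∗ Rm` monomials `rrField`;
* `IsMetricOn.sqrt_tnormSq_solKer_le`, **`IsMetricOn.sqrt_tnormSq_rdf_le` — the `d^∇Ric ∗ Rm` term
  `Σ_a tr((K ⊗ Rm) ∘ gamEquiv a)`, `K = (∇Ric − ∇Ric ∘ kerSwap₁₂) ∘ kerCyc⁻¹`, is `≤ 8n |Rm| |∇Rm|`**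
  (on a gradient soliton `R(·,∇f) ⋆ Rm` is this term, `CoordShrinkerCovRmNormSqDrift.lean`);
* `tnormSq_option_eq_sum_frame` (`|S|² = Σ_c |S(e_c,·)|²` in an orthonormal frame) and
  **`IsMetricOn.gradSqAt_tnormSq_le` — Kato's inequality `|∇|T|²|² ≤ 4 |T|² |∇T|²`** for covariant
  tensor fields of any rank (Munteanu–Wang 2015, proof of Thm. 1.4: `|∇|∇Rm|| ≤ |∇²Rm|`).

Everything is proved; no definition and no statement of `Prop` type is introduced.

## References

* P. Topping, *Lectures on the Ricci flow*, LMS Lecture Note Series 325, CUP 2006, §2.1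
  ((2.1.5)–(2.1.6)), §2.2, §3.3 ((3.3.4)). [Topping2006]
* O. Munteanu, J. Wang, *Geometry of shrinking Ricci solitons*, Compositio Math. 151 (2015)
  2273–2300 = arXiv:1410.3813, Thm. 1.4 (proof, p. 6) and Prop. 2.2 with (u1) (p. 7).
  [MunteanuWang2015]
* B. O'Neill, *Semi-Riemannian geometry with applications to relativity*, Academic Press 1983,
  Ch. 2, Lemma 2.25 ff. [ONeill1983]
-/

noncomputable section

set_option maxSynthPendingDepth 3

open Set Filter ContinuousLinearMap Module Function
open scoped Topology ContDiff

namespace Literature.Geometry.Lorentzian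

namespace MetricCoord

variable {E : Type*} [NormedAddCommGroup E] [NormedSpace ℝ E] {ι : Type*}

/-! ### The commutator `[Δ, ∇] Rm = Rm ∗ ∇Rm` and its bound -/

section Commutator

variable [Fintype ι] {G : E → E →L[ℝ] E →L[ℝ] ℝ} (b : Basis ι ℝ E) {V : Set E} {x : E}
  [FiniteDimensional ℝ E] [CompleteSpace E]

/-- **`∇(Rm ⋆_a Rm)` through the Leibniz rule**: at `x ∈ V`,
`∇ (ricTerm Rm a) = tr (((∇Rm ⊗ Rm) ∘ e_L + (Rm ⊗ ∇Rm) ∘ e_R) ∘ e_a⁺ ∘ cycTop)` componentwise.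
[cite: Topping2006, §2.1, (2.1.6)] -/
theorem IsMetricOn.tcov_ricTerm_rm4_apply (hG : IsMetricOn G V) (hx : x ∈ V) (a : Fin 4)
    (K : Option (Option (Option (Fin 4))) → ι) :
    tcov G b (ricTerm G b (rm4 G b) a) x K =
      ttr G b (treindex (cycTop (Option (Option (Fin 4)))) (treindex (ricEquiv a).optionCongr
        (treindex (sumOptionLeft (Fin 4) (Fin 4)) (tprod (tcov G b (rm4 G b)) (rm4 G b))
          + treindex (sumOptionRight (Fin 4) (Fin 4)) (tprod (rm4 G b) (tcov G b (rm4 G b)))))) x K := by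
  have hT := hG.tsmoothOn_rm4 b
  rw [tcov_congr hG.isOpen (hG.ricTerm_eq_ttr (b := b) (rm4 G b) a) hx K,
    hG.tcov_ttr_eq ((hT.tprod hT).treindex _) hx K, tcov_treindex]
  simp only [ttr_apply, treindex_apply, tcov_tprod_eq hG.isOpen hT hT hx]

/-- **`∇(W Rm) = −Σ_a ∇(Rm ⋆_a Rm)`** at the points of `V` (`W = tcov2Alt`, the Ricci identity).
[cite: Topping2006, §2.1, (2.1.5)] -/
theorem IsMetricOn.tcov_tcov2Alt_rm4_apply (hG : IsMetricOn G V) (hx : x ∈ V)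
    (K : Option (Option (Option (Fin 4))) → ι) :
    tcov G b (tcov2Alt G b (rm4 G b)) x K = -∑ a : Fin 4, tcov G b (ricTerm G b (rm4 G b) a) x K := by
  have hT := hG.tsmoothOn_rm4 b
  have hsm : ∀ a ∈ (Finset.univ : Finset (Fin 4)), TSmoothOn (ricTerm G b (rm4 G b) a) V :=
    fun a _ ↦ hG.tsmoothOn_ricTerm hT a
  have h : ∀ y ∈ V, ∀ I, tcov2Alt G b (rm4 G b) y I = (-(∑ a : Fin 4, ricTerm G b (rm4 G b) a)) y I := by
    intro y hy I
    rw [hG.tcov2Alt_eq hT y hy I]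
    simp only [Pi.neg_apply, Finset.sum_apply]
  rw [tcov_congr hG.isOpen h hx K, tcov_neg_apply hG.isOpen (TSmoothOn.sum _ hsm) hx,
    tcov_sum_apply _ hG.isOpen hsm hx]

/-- **`|∇(W Rm)| ≤ 8√n |Rm| |∇Rm|`** at positive definite points. [cite: Topping2006, §3.3, (3.3.4)] -/
theorem IsMetricOn.sqrt_tnormSq_tcov_tcov2Alt_le (hG : IsMetricOn G V) (hx : x ∈ V)
    (hpos : ∀ v, v ≠ 0 → 0 < G x v v) :
    Real.sqrt (tnormSq G b (tcov G b (tcov2Alt G b (rm4 G b))) x) ≤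
      8 * Real.sqrt (Fintype.card ι) * Real.sqrt (tnormSq G b (rm4 G b) x) *
        Real.sqrt (tnormSq G b (tcov G b (rm4 G b)) x) := by
  have hs := hG.symm x hx
  set P := treindex (sumOptionLeft (Fin 4) (Fin 4)) (tprod (tcov G b (rm4 G b)) (rm4 G b))
    + treindex (sumOptionRight (Fin 4) (Fin 4)) (tprod (rm4 G b) (tcov G b (rm4 G b))) with hP
  have hPn : Real.sqrt (tnormSq G b P x) ≤
      2 * Real.sqrt (tnormSq G b (rm4 G b) x) * Real.sqrt (tnormSq G b (tcov G b (rm4 G b)) x) := by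
    refine (sqrt_tnormSq_add_le b hs hpos _ _).trans ?_
    rw [tnormSq_treindex, tnormSq_treindex, sqrt_tnormSq_tprod b hs hpos, sqrt_tnormSq_tprod b hs hpos]
    linarith
  have heq : tnormSq G b (tcov G b (tcov2Alt G b (rm4 G b))) x =
      tnormSq G b (-(∑ a : Fin 4, ttr G b (treindex (cycTop (Option (Option (Fin 4))))
        (treindex (ricEquiv a).optionCongr P)))) x := by
    refine IsMetricFamilyOn.tnormSq_congr_point b fun K ↦ ?_
    rw [hG.tcov_tcov2Alt_rm4_apply b hx K]
    simp only [Pi.neg_apply, Finset.sum_apply, hG.tcov_ricTerm_rm4_apply b hx, hP]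
  have hterm : ∀ a : Fin 4, Real.sqrt (tnormSq G b (ttr G b (treindex (cycTop (Option (Option (Fin 4))))
      (treindex (ricEquiv a).optionCongr P))) x) ≤ Real.sqrt (Fintype.card ι) *
        (2 * Real.sqrt (tnormSq G b (rm4 G b) x) * Real.sqrt (tnormSq G b (tcov G b (rm4 G b)) x)) := by
    intro a
    refine (sqrt_tnormSq_ttr_le b hs hpos _).trans ?_
    rw [tnormSq_treindex, tnormSq_treindex]
    exact mul_le_mul_of_nonneg_left hPn (Real.sqrt_nonneg _)
  rw [heq, tnormSq_neg]
  refine (sqrt_tnormSq_sum_le b hs hpos _ _).trans ?_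
  refine (Finset.sum_le_sum fun a _ ↦ hterm a).trans ?_
  rw [Finset.sum_const, Finset.card_univ, Fintype.card_fin, nsmul_eq_mul]
  norm_num
  linarith

/-- **`|W(∇Rm)| ≤ 5√n |Rm| |∇Rm|`** (`W(∇Rm) = −Σ_a Rm ⋆_a ∇Rm`, five slots).
[cite: Topping2006, §3.3, (3.3.4)] -/
theorem IsMetricOn.sqrt_tnormSq_tcov2Alt_tcov_le (hG : IsMetricOn G V) (hx : x ∈ V)
    (hpos : ∀ v, v ≠ 0 → 0 < G x v v) :
    Real.sqrt (tnormSq G b (tcov2Alt G b (tcov G b (rm4 G b))) x) ≤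
      5 * Real.sqrt (Fintype.card ι) * Real.sqrt (tnormSq G b (rm4 G b) x) *
        Real.sqrt (tnormSq G b (tcov G b (rm4 G b)) x) := by
  have hs := hG.symm x hx
  have hi := hG.isInvertible x hx
  have hD := hG.tsmoothOn_tcov (b := b) (hG.tsmoothOn_rm4 b)
  have heq : tnormSq G b (tcov2Alt G b (tcov G b (rm4 G b))) x =
      tnormSq G b (-(∑ a : Option (Fin 4), ttr G b (treindex (ricEquiv a)
        (tprod (rm4 G b) (tcov G b (rm4 G b)))))) x := by
    refine IsMetricFamilyOn.tnormSq_congr_point b fun K ↦ ?_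
    rw [hG.tcov2Alt_eq hD x hx K]
    simp only [Pi.neg_apply, Finset.sum_apply, MetricCoord.ricTerm_eq_ttr hi]
  have hterm : ∀ a : Option (Fin 4), Real.sqrt (tnormSq G b (ttr G b (treindex (ricEquiv a)
      (tprod (rm4 G b) (tcov G b (rm4 G b))))) x) ≤ Real.sqrt (Fintype.card ι) *
        (Real.sqrt (tnormSq G b (rm4 G b) x) * Real.sqrt (tnormSq G b (tcov G b (rm4 G b)) x)) := by
    intro a
    refine (sqrt_tnormSq_ttr_le b hs hpos _).trans ?_
    rw [tnormSq_treindex, sqrt_tnormSq_tprod b hs hpos]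
  rw [heq, tnormSq_neg]
  refine (sqrt_tnormSq_sum_le b hs hpos _ _).trans ?_
  refine (Finset.sum_le_sum fun a _ ↦ hterm a).trans ?_
  rw [Finset.sum_const, Finset.card_univ, Fintype.card_option, Fintype.card_fin, nsmul_eq_mul]
  norm_num
  linarith

/-- **`|[Δ, ∇]Rm| ≤ 13 n |Rm| |∇Rm|`**: the trace field `tr(∇(W Rm) + W(∇Rm) ∘ σ)` of
`tlap_tcov_sub_tcov_tlap` (Topping's (2.1.6): `Δ(∇T) − ∇(ΔT) = Rm ∗ ∇T + ∇Rm ∗ T`, `T = Rm`).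
[cite: Topping2006, §2.1, (2.1.6)] -/
theorem IsMetricOn.sqrt_tnormSq_commutator_le (hG : IsMetricOn G V) (hx : x ∈ V)
    (hpos : ∀ v, v ≠ 0 → 0 < G x v v) :
    Real.sqrt (tnormSq G b (ttr G b (tcov G b (tcov2Alt G b (rm4 G b))
        + treindex (Equiv.swap (some none) (some (some none))) (tcov2Alt G b (tcov G b (rm4 G b))))) x) ≤
      13 * Fintype.card ι * Real.sqrt (tnormSq G b (rm4 G b) x) *
        Real.sqrt (tnormSq G b (tcov G b (rm4 G b)) x) := by
  have hs := hG.symm x hx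
  have hn : Real.sqrt (Fintype.card ι) * Real.sqrt (Fintype.card ι) = Fintype.card ι :=
    Real.mul_self_sqrt (Nat.cast_nonneg _)
  have h1 := hG.sqrt_tnormSq_tcov_tcov2Alt_le b hx hpos
  have h2 := hG.sqrt_tnormSq_tcov2Alt_tcov_le b hx hpos
  refine (sqrt_tnormSq_ttr_le b hs hpos _).trans ?_
  have h3 := sqrt_tnormSq_add_le b hs hpos (tcov G b (tcov2Alt G b (rm4 G b)))
    (treindex (Equiv.swap (some none) (some (some none))) (tcov2Alt G b (tcov G b (rm4 G b))))
  rw [tnormSq_treindex] at h3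
  have h0 : 0 ≤ Real.sqrt (Fintype.card ι) := Real.sqrt_nonneg _
  calc Real.sqrt (Fintype.card ι) * Real.sqrt (tnormSq G b (tcov G b (tcov2Alt G b (rm4 G b))
        + treindex (Equiv.swap (some none) (some (some none))) (tcov2Alt G b (tcov G b (rm4 G b)))) x)
      ≤ Real.sqrt (Fintype.card ι) * (13 * Real.sqrt (Fintype.card ι) *
          (Real.sqrt (tnormSq G b (rm4 G b) x) * Real.sqrt (tnormSq G b (tcov G b (rm4 G b)) x))) :=
        mul_le_mul_of_nonneg_left (by linarith) h0
    _ = _ := by linear_combination (13 * (Real.sqrt (tnormSq G b (rm4 G b) x) *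
          Real.sqrt (tnormSq G b (tcov G b (rm4 G b)) x))) * hn

end Commutator

/-! ### `∇` of the `Rm ∗ Rm` monomials and the `d^∇Ric ∗ Rm` kernel -/

section Monomials

variable [Fintype ι] {G : E → E →L[ℝ] E →L[ℝ] ℝ} (b : Basis ι ℝ E) {V : Set E} {x : E}
  [FiniteDimensional ℝ E] [CompleteSpace E]

/-- **`∇` of an `Rm ∗ Rm` monomial through the Leibniz rule**: at `x ∈ V`,
`∇ tr tr((Rm ⊗ Rm) ∘ e) = tr(tr((((∇Rm ⊗ Rm) ∘ e_L + (Rm ⊗ ∇Rm) ∘ e_R) ∘ e⁺) ∘ cycTop) ∘ cycTop)`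
componentwise. [cite: Topping2006, §2.2] -/
theorem IsMetricOn.tcov_rrField_apply (hG : IsMetricOn G V) (hx : x ∈ V)
    (e : Fin 4 ⊕ Fin 4 ≃ Option (Option (Option (Option (Fin 4))))) (K : Option (Fin 4) → ι) :
    tcov G b (rrField G b e) x K =
      ttr G b (treindex (cycTop (Fin 4)) (ttr G b (treindex (cycTop (Option (Option (Fin 4))))
        (treindex e.optionCongr
          (treindex (sumOptionLeft (Fin 4) (Fin 4)) (tprod (tcov G b (rm4 G b)) (rm4 G b))
            + treindex (sumOptionRight (Fin 4) (Fin 4)) (tprod (rm4 G b) (tcov G b (rm4 G b)))))))) x K := by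
  have hT := hG.tsmoothOn_rm4 b
  unfold rrField
  rw [hG.tcov_ttr_eq (hG.tsmoothOn_ttr ((hT.tprod hT).treindex e)) hx K]
  simp only [ttr_apply, treindex_apply, hG.tcov_ttr_eq ((hT.tprod hT).treindex e) hx, tcov_treindex,
    tcov_tprod_eq hG.isOpen hT hT hx]

/-- **`|∇(Rm ∗ Rm monomial)| ≤ 2n |Rm| |∇Rm|`** at positive definite points. [cite: Topping2006, §3.3, (3.3.4)] -/
theorem IsMetricOn.sqrt_tnormSq_tcov_rrField_le (hG : IsMetricOn G V) (hx : x ∈ V)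
    (hpos : ∀ v, v ≠ 0 → 0 < G x v v) (e : Fin 4 ⊕ Fin 4 ≃ Option (Option (Option (Option (Fin 4))))) :
    Real.sqrt (tnormSq G b (tcov G b (rrField G b e)) x) ≤
      2 * Fintype.card ι * Real.sqrt (tnormSq G b (rm4 G b) x) *
        Real.sqrt (tnormSq G b (tcov G b (rm4 G b)) x) := by
  have hs := hG.symm x hx
  have hn : Real.sqrt (Fintype.card ι) * Real.sqrt (Fintype.card ι) = Fintype.card ι :=
    Real.mul_self_sqrt (Nat.cast_nonneg _)
  have h0 : 0 ≤ Real.sqrt (Fintype.card ι) := Real.sqrt_nonneg _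
  set P := treindex (sumOptionLeft (Fin 4) (Fin 4)) (tprod (tcov G b (rm4 G b)) (rm4 G b))
    + treindex (sumOptionRight (Fin 4) (Fin 4)) (tprod (rm4 G b) (tcov G b (rm4 G b))) with hP
  have hPn : Real.sqrt (tnormSq G b P x) ≤
      2 * Real.sqrt (tnormSq G b (rm4 G b) x) * Real.sqrt (tnormSq G b (tcov G b (rm4 G b)) x) := by
    refine (sqrt_tnormSq_add_le b hs hpos _ _).trans ?_
    rw [tnormSq_treindex, tnormSq_treindex, sqrt_tnormSq_tprod b hs hpos, sqrt_tnormSq_tprod b hs hpos]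
    linarith
  rw [IsMetricFamilyOn.tnormSq_congr_point b fun K ↦ hG.tcov_rrField_apply b hx e K]
  refine (sqrt_tnormSq_ttr_le b hs hpos _).trans ?_
  rw [tnormSq_treindex]
  have h2 := sqrt_tnormSq_ttr_le b hs hpos (treindex (cycTop (Option (Option (Fin 4)))) (treindex e.optionCongr P))
  rw [tnormSq_treindex, tnormSq_treindex] at h2
  calc Real.sqrt (Fintype.card ι) * Real.sqrt (tnormSq G b (ttr G b (treindex (cycTop (Option (Option (Fin 4))))
        (treindex e.optionCongr P))) x)
      ≤ Real.sqrt (Fintype.card ι) * (Real.sqrt (Fintype.card ι) *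
          (2 * Real.sqrt (tnormSq G b (rm4 G b) x) * Real.sqrt (tnormSq G b (tcov G b (rm4 G b)) x))) :=
        mul_le_mul_of_nonneg_left (h2.trans (mul_le_mul_of_nonneg_left hPn h0)) h0
    _ = _ := by linear_combination (2 * Real.sqrt (tnormSq G b (rm4 G b) x) *
          Real.sqrt (tnormSq G b (tcov G b (rm4 G b)) x)) * hn

/-- The kernel `K(i; p, l) = (∇_{b_p}Ric)(b_l, b_i) − (∇_{b_l}Ric)(b_p, b_i)` (= `R(b_i,∇f,b_p,b_l)` on a
gradient soliton) has `|K| ≤ 2√n |∇Rm|`. [cite: MunteanuWang2015, Thm. 1.4 (proof) and (u1)] -/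
theorem IsMetricOn.sqrt_tnormSq_solKer_le (hG : IsMetricOn G V) (hx : x ∈ V)
    (hpos : ∀ v, v ≠ 0 → 0 < G x v v) :
    Real.sqrt (tnormSq G b (treindex kerCyc.symm
        (tcov G b (ric2 G b) - treindex kerSwap₁₂ (tcov G b (ric2 G b)))) x) ≤
      2 * Real.sqrt (Fintype.card ι) * Real.sqrt (tnormSq G b (tcov G b (rm4 G b)) x) := by
  have hs := hG.symm x hx
  rw [tnormSq_treindex]
  refine (sqrt_tnormSq_sub_le b hs hpos _ _).trans ?_
  rw [tnormSq_treindex]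
  have h := hG.sqrt_tnormSq_tcov_ric2_le b hx hpos
  linarith

/-- **The `d^∇Ric ∗ Rm` term `Σ_a tr((K ⊗ Rm) ∘ gamEquiv a)` is bounded by `8n |Rm| |∇Rm|`**
(on a gradient soliton this is the term `R(·,∇f) ⋆ Rm` of `∇(∇_{∇f}Rm) − ∇_{∇f}∇Rm`).
[cite: MunteanuWang2015, Thm. 1.4 (proof) and (u1)] -/
theorem IsMetricOn.sqrt_tnormSq_rdf_le (hG : IsMetricOn G V) (hx : x ∈ V)
    (hpos : ∀ v, v ≠ 0 → 0 < G x v v) :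
    Real.sqrt (tnormSq G b (∑ a : Fin 4, ttr G b (treindex (gamEquiv a) (tprod (treindex kerCyc.symm
        (tcov G b (ric2 G b) - treindex kerSwap₁₂ (tcov G b (ric2 G b)))) (rm4 G b)))) x) ≤
      8 * Fintype.card ι * Real.sqrt (tnormSq G b (rm4 G b) x) *
        Real.sqrt (tnormSq G b (tcov G b (rm4 G b)) x) := by
  have hs := hG.symm x hx
  have hn : Real.sqrt (Fintype.card ι) * Real.sqrt (Fintype.card ι) = Fintype.card ι :=
    Real.mul_self_sqrt (Nat.cast_nonneg _)
  set Kp := treindex kerCyc.symm (tcov G b (ric2 G b) - treindex kerSwap₁₂ (tcov G b (ric2 G b))) with hKp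
  have hterm : ∀ a : Fin 4, Real.sqrt (tnormSq G b (ttr G b (treindex (gamEquiv a) (tprod Kp (rm4 G b)))) x) ≤
      2 * Fintype.card ι * Real.sqrt (tnormSq G b (rm4 G b) x) *
        Real.sqrt (tnormSq G b (tcov G b (rm4 G b)) x) := by
    intro a
    calc Real.sqrt (tnormSq G b (ttr G b (treindex (gamEquiv a) (tprod Kp (rm4 G b)))) x)
        ≤ Real.sqrt (Fintype.card ι) * Real.sqrt (tnormSq G b (treindex (gamEquiv a) (tprod Kp (rm4 G b))) x) :=
          sqrt_tnormSq_ttr_le b hs hpos _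
      _ = Real.sqrt (Fintype.card ι) * (Real.sqrt (tnormSq G b Kp x) * Real.sqrt (tnormSq G b (rm4 G b) x)) := by
          rw [tnormSq_treindex, sqrt_tnormSq_tprod b hs hpos]
      _ ≤ Real.sqrt (Fintype.card ι) * ((2 * Real.sqrt (Fintype.card ι) *
            Real.sqrt (tnormSq G b (tcov G b (rm4 G b)) x)) * Real.sqrt (tnormSq G b (rm4 G b) x)) := by
          gcongr
          exact hG.sqrt_tnormSq_solKer_le b hx hpos
      _ = _ := by
          linear_combination (2 * Real.sqrt (tnormSq G b (rm4 G b) x) *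
            Real.sqrt (tnormSq G b (tcov G b (rm4 G b)) x)) * hn
  refine (sqrt_tnormSq_sum_le b hs hpos _ _).trans ?_
  calc ∑ a : Fin 4, Real.sqrt (tnormSq G b (ttr G b (treindex (gamEquiv a) (tprod Kp (rm4 G b)))) x)
      ≤ ∑ _a : Fin 4, 2 * Fintype.card ι * Real.sqrt (tnormSq G b (rm4 G b) x) *
          Real.sqrt (tnormSq G b (tcov G b (rm4 G b)) x) := Finset.sum_le_sum fun a _ ↦ hterm a
    _ = _ := by rw [Finset.sum_const, Finset.card_univ, Fintype.card_fin, nsmul_eq_mul]; ring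

omit [Fintype ι] [FiniteDimensional ℝ E] [CompleteSpace E] in
/-- `(j,k,i,m) ∘ (2,3,0,1) = (i,m,j,k)`. [folklore] -/
theorem vec4_comp_perm₁ (j k i m : ι) :
    (![j, k, i, m] : Fin 4 → ι) ∘ (![(2 : Fin 4), 3, 0, 1] : Fin 4 → Fin 4) = ![i, m, j, k] := by
  funext c; fin_cases c <;> rfl

omit [Fintype ι] [FiniteDimensional ℝ E] [CompleteSpace E] in
/-- `(j,k,i,m) ∘ (2,3,1,0) = (i,m,k,j)`. [folklore] -/
theorem vec4_comp_perm₂ (j k i m : ι) :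
    (![j, k, i, m] : Fin 4 → ι) ∘ (![(2 : Fin 4), 3, 1, 0] : Fin 4 → Fin 4) = ![i, m, k, j] := by
  funext c; fin_cases c <;> rfl

omit [Fintype ι] [FiniteDimensional ℝ E] [CompleteSpace E] in
/-- `(j,k,i,m) ∘ swap 0 1 = (k,j,i,m)`. [folklore] -/
theorem vec4_comp_swap01 (j k i m : ι) :
    (![j, k, i, m] : Fin 4 → ι) ∘ (Equiv.swap (0 : Fin 4) 1) = ![k, j, i, m] := by
  funext c
  fin_cases c
  · simp
  · simp
  · rw [Function.comp_apply, Equiv.swap_apply_of_ne_of_ne (by decide) (by decide)]; rfl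
  · rw [Function.comp_apply, Equiv.swap_apply_of_ne_of_ne (by decide) (by decide)]; rfl

end Monomials

/-! ### Kato's inequality `|∇|T|²|² ≤ 4|T|²|∇T|²` -/

section Kato

variable [Fintype ι] {G : E → E →L[ℝ] E →L[ℝ] ℝ} (b : Basis ι ℝ E) {V : Set E} {x : E}
  [FiniteDimensional ℝ E] {α : Type*} [Fintype α] [DecidableEq α]

/-- `|Σ_j w_j S_{j·}|²` expanded. [folklore] -/
theorem tnormSq_sum_mul_ocons (w : ι → ℝ) (S : E → (Option α → ι) → ℝ) :
    tnormSq G b (fun y I ↦ ∑ j, w j * S y (ocons j I)) x =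
      ∑ k, ∑ l, w k * w l * ∑ I : α → ι, ∑ J : α → ι, (∏ a, ginv G b x (I a) (J a)) *
        (S x (ocons k I) * S x (ocons l J)) := by
  rw [tnormSq_eq, tinner_apply]
  simp only [Finset.sum_mul, Finset.mul_sum]
  rw [sum_comm₂₂, Finset.sum_comm]
  exact Finset.sum_congr rfl fun k _ ↦ Finset.sum_congr rfl fun l _ ↦
    Finset.sum_congr rfl fun I _ ↦ Finset.sum_congr rfl fun J _ ↦ by ring

/-- **`|S|² = Σ_c |S(e_c, ·)|²` in a `G x`-orthonormal frame** for a tensor with a distinguished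
first slot (`g^{kl} = Σ_c bᵏ(e_c) bˡ(e_c)`). [cite: ONeill1983, Ch. 2, Lemma 2.25 ff.] -/
theorem tnormSq_option_eq_sum_frame {κ : Type*} [Fintype κ] [DecidableEq κ] (e : Basis κ ℝ E)
    (he : ∀ c d, G x (e c) (e d) = if c = d then 1 else 0) (hi : (G x).IsInvertible)
    (hs : ∀ v w, G x v w = G x w v) (S : E → (Option α → ι) → ℝ) :
    tnormSq G b S x = ∑ c, tnormSq G b (fun y I ↦ ∑ j, b.coord j (e c) * S y (ocons j I)) x := by
  rw [tnormSq_eq, tinner_option]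
  simp only [tnormSq_sum_mul_ocons]
  rw [← sum_comm₃']
  refine Finset.sum_congr rfl fun k _ ↦ Finset.sum_congr rfl fun l _ ↦ ?_
  rw [ginv_eq_sum_coord_frame b e he hi hs k l, Finset.sum_mul]

variable [CompleteSpace E]

/-- **Kato's inequality for a covariant tensor field, squared, in coordinates**:
`|∇|T|²|² ≤ 4 |T|² |∇T|²` at positive definite points of `V` (`d|T|²(e_c) = 2⟨∇_{e_c}T, T⟩` in an
orthonormal frame, Cauchy–Schwarz, and `Σ_c |∇_{e_c}T|² = |∇T|²`); for `T = ∇Rm` this is the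
form `|∇|∇Rm|| ≤ |∇²Rm|` used in the proof of Munteanu–Wang 2015, Thm. 1.4.
[cite: MunteanuWang2015, Thm. 1.4 (proof) and (u1)] -/
theorem IsMetricOn.gradSqAt_tnormSq_le (hG : IsMetricOn G V) (hx : x ∈ V)
    (hpos : ∀ v, v ≠ 0 → 0 < G x v v) {T : E → (α → ι) → ℝ} (hT : TSmoothOn T V) :
    gradSqAt G (tnormSq G b T) x ≤ 4 * tnormSq G b T x * tnormSq G b (tcov G b T) x := by
  classical
  have hs := hG.symm x hx
  have hi := hG.isInvertible x hx
  obtain ⟨e, he⟩ := exists_orthonormal_basis hs hpos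
  have hgrad : gradSqAt G (tnormSq G b T) x = ∑ c, (fderiv ℝ (tnormSq G b T) x (e c)) ^ 2 := by
    rw [gradSqAt_apply]
    conv_lhs => rw [← sum_apply_smul_of_orthonormal e he (sharpAt G x (fderiv ℝ (tnormSq G b T) x))]
    rw [map_sum]
    refine Finset.sum_congr rfl fun c _ ↦ ?_
    rw [map_smul, smul_eq_mul, apply_sharpAt_apply hi, sq]
  have hdc : ∀ c, fderiv ℝ (tnormSq G b T) x (e c) =
      2 * tinner G b (fun y I ↦ ∑ j, b.coord j (e c) * tcov G b T y (ocons j I)) T x := by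
    intro c
    conv_lhs => rw [← sum_coord_smul b (e c)]
    rw [map_sum]
    simp only [map_smul, smul_eq_mul, hG.fderiv_tnormSq hT hx]
    rw [tinner_sum_mul_ocons, Finset.mul_sum]
    exact Finset.sum_congr rfl fun q _ ↦ by ring
  rw [hgrad, tnormSq_option_eq_sum_frame b e he hi hs (tcov G b T), Finset.mul_sum]
  refine Finset.sum_le_sum fun c _ ↦ ?_
  rw [hdc c]
  have hCS := abs_tinner_le b hs hpos (fun y I ↦ ∑ j, b.coord j (e c) * tcov G b T y (ocons j I)) T
  have h1 := pow_le_pow_left₀ (abs_nonneg _) hCS 2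
  rw [mul_pow, Real.sq_sqrt (tnormSq_nonneg b hs hpos _), Real.sq_sqrt (tnormSq_nonneg b hs hpos _),
    sq_abs] at h1
  linarith

end Kato

end MetricCoord

end Literature.Geometry.Lorentzian

end
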